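import Summits.CriticalPhenomena.CardyFormulaZ2.Theorems.CardySelfRefinementLagHandOffHalfPlaneTwoArmUndockedSum
import HarnessLib

/-!
# The bootstrap step of the undocked half-plane two-arm bound (exponent arithmetic)

Support file for the registered stub `stub_noTouch_undockedThreeArm` of crux
stmt-CriticalPhenomena-10268 (line `hitting-tournament`), towards the undocked half-plane two-arm
bound (X) for critical bond percolation on `ℤ²`.  From the multiscale sum bound
`P(E(c₀; r, R)) ≤ (C_d r₀ L/(2R)) Σ_{j<J} (L q)^j + q^J` (`q = A L^{-(θ+α)}`, `r₀ = 2r + 9`,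
`stub_undockedTwoArm_sumBound`) with the largest admissible number of scales `J`
(`L^J ≤ X := R/(K_d r₀) < L^{J+1}`) and a ratio `L` so large that `max 1 A ≤ L^γ`,
`γ = (min 1 (θ+α) - η)/2`, elementary arithmetic (`Σ_{j<J} (Lq)^j ≤ J M^J` with
`M = (max 1 A) L^{max (1-θ-α) 0}`, `J ≤ (L^J)^γ/(L^γ - 1)`, `(max 1 A)^J ≤ (L^J)^γ`) gives

* `stub_undockedTwoArm_latticeStep` — **the undocked two-arm bound with exponent `θ` (general
  centres and meshes) and the RSW dual-crossing bound with exponent `α` imply the undocked two-arm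
  bound around LATTICE centres at mesh `1` with any exponent `η < min 1 (θ + α)`.**

References: H. Kesten, Comm. Math. Phys. 109 (1987), Lemma 4 [KestenScalingCMP1987]; G. F. Lawler,
O. Schramm, W. Werner, Electron. J. Probab. 7 (2002), Appendix A [LawlerSchrammWernerEJP2002].
-/

noncomputable section

open Set Metric Complex MeasureTheory
open Literature.Probability.Percolation Literature.Probability.LatticeModels

namespace Summit.CriticalPhenomena.CardyFormulaZ2.Cruxes.LagHandOff.HittingTournament

/-! ### Elementary arithmetic -/

/-- `Σ_{j<J} t^j ≤ J M^J` for `0 ≤ t ≤ M`, `1 ≤ M`. [folklore] -/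
theorem sum_pow_le_mul_pow {t M : ℝ} (ht : 0 ≤ t) (htM : t ≤ M) (hM : 1 ≤ M) (J : ℕ) :
    ∑ j ∈ Finset.range J, t ^ j ≤ J * M ^ J := by
  calc ∑ j ∈ Finset.range J, t ^ j ≤ ∑ _j ∈ Finset.range J, M ^ J := by
        refine Finset.sum_le_sum fun j hj => ?_
        exact (pow_le_pow_left₀ ht htM j).trans (pow_le_pow_right₀ hM (Finset.mem_range.1 hj).le)
    _ = J * M ^ J := by rw [Finset.sum_const, Finset.card_range, nsmul_eq_mul]

/-- `J ≤ b^J / (b - 1)` for `b > 1` (Bernoulli's inequality). [folklore] -/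
theorem natCast_le_pow_div {b : ℝ} (hb : 1 < b) (J : ℕ) : (J : ℝ) ≤ b ^ J / (b - 1) := by
  have h := one_add_mul_le_pow (show (-2 : ℝ) ≤ b - 1 by linarith) J
  rw [add_sub_cancel] at h
  rw [le_div_iff₀ (by linarith)]
  linarith

/-- `min 1 κ + max (1 - κ) 0 = 1`. [folklore] -/
theorem min_add_max_eq_one (κ : ℝ) : min 1 κ + max (1 - κ) 0 = 1 := by
  rcases le_total κ 1 with h | h
  · rw [min_eq_right h, max_eq_left (by linarith)]; ring
  · rw [min_eq_left h, max_eq_right (by linarith)]; ring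

/-- The geometric part: `Σ_{j<J} (L q)^j ≤ (X^γ/(L^γ - 1)) · X^γ · X^{m₀}` when `q = A L^{-κ}`,
`A ≤ A' ≤ L^γ`, `1 ≤ A'`, `1 - κ ≤ m₀`, `0 ≤ m₀`, `1 ≤ L^J ≤ X`. [folklore] -/
theorem step_sum_le {L A A' γ κ m₀ X : ℝ} {J : ℕ} (hL1 : 1 < L) (hA0 : 0 ≤ A) (hAA' : A ≤ A') (hA'1 : 1 ≤ A')
    (hLγ : A' ≤ L ^ γ) (hγ0 : 0 < γ) (hm₀0 : 0 ≤ m₀) (hκm : 1 - κ ≤ m₀) (hYX : L ^ J ≤ X) :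
    ∑ j ∈ Finset.range J, (L * (A * L ^ (-κ))) ^ j ≤ (X ^ γ / (L ^ γ - 1)) * (X ^ γ * X ^ m₀) := by
  have hL0 : 0 < L := by linarith
  have hY1 : 1 ≤ L ^ J := one_le_pow₀ hL1.le
  have hY0 : (0 : ℝ) ≤ L ^ J := by linarith
  have hX0 : 0 < X := by linarith
  have hcomm : ∀ t : ℝ, (L ^ t) ^ J = (L ^ J) ^ t := fun t => by
    rw [← Real.rpow_natCast (L ^ t) J, ← Real.rpow_mul hL0.le, ← Real.rpow_natCast L J, ← Real.rpow_mul hL0.le, mul_comm]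
  set M : ℝ := A' * L ^ m₀ with hM
  have hLm₀ : 1 ≤ L ^ m₀ := Real.one_le_rpow hL1.le hm₀0
  have hM1 : 1 ≤ M := by
    rw [hM]; have := mul_le_mul hA'1 hLm₀ (by norm_num) (by linarith); rwa [one_mul] at this
  have hLq : L * (A * L ^ (-κ)) ≤ M := by
    have h1 : L * L ^ (-κ) = L ^ (1 - κ) := by rw [sub_eq_add_neg, Real.rpow_add hL0, Real.rpow_one]
    have h2 : L ^ (1 - κ) ≤ L ^ m₀ := Real.rpow_le_rpow_of_exponent_le hL1.le hκm
    calc L * (A * L ^ (-κ)) = A * (L * L ^ (-κ)) := by ring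
      _ ≤ A' * L ^ m₀ := by rw [h1]; exact mul_le_mul hAA' h2 (by positivity) (by linarith)
  have hb1 : 1 < L ^ γ := Real.one_lt_rpow hL1 hγ0
  have hb0 : 0 < L ^ γ - 1 := by linarith
  have hbJ : (L ^ γ) ^ J = (L ^ J) ^ γ := hcomm γ
  have hYγ : A' ^ J ≤ X ^ γ :=
    calc A' ^ J ≤ (L ^ γ) ^ J := pow_le_pow_left₀ (by linarith) hLγ J
      _ = (L ^ J) ^ γ := hbJ
      _ ≤ X ^ γ := Real.rpow_le_rpow hY0 hYX hγ0.le
  have hJle : (J : ℝ) ≤ X ^ γ / (L ^ γ - 1) :=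
    calc (J : ℝ) ≤ (L ^ γ) ^ J / (L ^ γ - 1) := natCast_le_pow_div hb1 J
      _ ≤ X ^ γ / (L ^ γ - 1) := by
          rw [hbJ]; exact div_le_div_of_nonneg_right (Real.rpow_le_rpow hY0 hYX hγ0.le) hb0.le
  have hMJ : M ^ J ≤ X ^ γ * X ^ m₀ := by
    rw [hM, mul_pow, hcomm m₀]
    exact mul_le_mul hYγ (Real.rpow_le_rpow hY0 hYX hm₀0) (Real.rpow_nonneg hY0 _) (Real.rpow_nonneg hX0.le _)
  have hM0 : 0 ≤ M := by linarith
  calc ∑ j ∈ Finset.range J, (L * (A * L ^ (-κ))) ^ j ≤ J * M ^ J := sum_pow_le_mul_pow (by positivity) hLq hM1 J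
    _ ≤ (X ^ γ / (L ^ γ - 1)) * (X ^ γ * X ^ m₀) :=
        mul_le_mul hJle hMJ (pow_nonneg hM0 J) (div_nonneg (Real.rpow_nonneg hX0.le _) hb0.le)

/-- The tail part: `q^J ≤ L^κ X^{-η}` when `q = A L^{-κ}`, `A ≤ A' ≤ L^γ`, `γ ≤ κ - η`,
`1 ≤ L^J ≤ X < L · L^J`, `1 ≤ X`. [folklore] -/
theorem step_tail_le {L A A' γ κ η X : ℝ} {J : ℕ} (hL1 : 1 < L) (hA0 : 0 ≤ A) (hAA' : A ≤ A')
    (hLγ : A' ≤ L ^ γ) (hγ0 : 0 < γ) (hγκ : γ ≤ κ - η) (hκ0 : 0 < κ) (hYX : L ^ J ≤ X) (hXLY : X < L * L ^ J)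
    (hX1 : 1 ≤ X) : (A * L ^ (-κ)) ^ J ≤ L ^ κ * X ^ (-η) := by
  have hL0 : 0 < L := by linarith
  have hY1 : 1 ≤ L ^ J := one_le_pow₀ hL1.le
  have hY0 : (0 : ℝ) < L ^ J := by linarith
  have hX0 : 0 < X := by linarith
  have hcomm : ∀ t : ℝ, (L ^ t) ^ J = (L ^ J) ^ t := fun t => by
    rw [← Real.rpow_natCast (L ^ t) J, ← Real.rpow_mul hL0.le, ← Real.rpow_natCast L J, ← Real.rpow_mul hL0.le, mul_comm]
  have h1 : (A * L ^ (-κ)) ^ J = A ^ J * (L ^ J) ^ (-κ) := by rw [mul_pow, hcomm (-κ)]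
  have h2 : A ^ J ≤ X ^ γ :=
    calc A ^ J ≤ (L ^ γ) ^ J := pow_le_pow_left₀ hA0 (hAA'.trans hLγ) J
      _ = (L ^ J) ^ γ := hcomm γ
      _ ≤ X ^ γ := Real.rpow_le_rpow hY0.le hYX hγ0.le
  have h3 : (L ^ J) ^ (-κ) ≤ (X / L) ^ (-κ) :=
    Real.rpow_le_rpow_of_nonpos (by positivity) (by rw [div_le_iff₀ hL0]; linarith) (by linarith)
  have h4 : (X / L) ^ (-κ) = L ^ κ * X ^ (-κ) := by
    rw [Real.div_rpow hX0.le hL0.le, Real.rpow_neg hL0.le]; field_simp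
  have h5 : X ^ γ * X ^ (-κ) ≤ X ^ (-η) := by
    rw [← Real.rpow_add hX0]
    exact Real.rpow_le_rpow_of_exponent_le hX1 (by linarith)
  calc (A * L ^ (-κ)) ^ J = A ^ J * (L ^ J) ^ (-κ) := h1
    _ ≤ X ^ γ * (L ^ κ * X ^ (-κ)) := mul_le_mul h2 (h3.trans h4.le) (by positivity) (by positivity)
    _ = L ^ κ * (X ^ γ * X ^ (-κ)) := by ring
    _ ≤ L ^ κ * X ^ (-η) := mul_le_mul_of_nonneg_left h5 (by positivity)

/-! ### The step -/

/-- **The bootstrap step at lattice centres.**  Assume the undocked two-arm bound with exponent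
`θ > 0` (all centres `x`, all meshes `δ`; constants `C, c_b, K`) and the RSW bound with exponent
`α > 0` for closed dual annulus crossings.  Then for every `η` with `0 < η < 1`, `η < θ + α`, the
undocked two-arm event around every lattice centre `c₀` at mesh `1` with radii `c_b' ≤ r`,
`K' r ≤ R` has probability `≤ C' (r/R)^η`. [cite: KestenScalingCMP1987, Lemma 4] -/
theorem stub_undockedTwoArm_latticeStep : ∀ {θ C cb K : ℝ}, 0 < θ → 0 < C → 0 < cb → 1 ≤ K →
    (∀ (x : ℂ) (δ r R : ℝ), 0 < δ → cb * δ ≤ r → K * r ≤ R → ∀ S : Set (Site 2),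
      S = {v | r ≤ dist (meshPoint δ v) x ∧ dist (meshPoint δ v) x ≤ R ∧ x.im ≤ (meshPoint δ v).im} →
      (bondPercolation (zdGraph 2) half).real {ω | ∃ v w f g : Site 2,
        dist (meshPoint δ v) x ≤ 2 * r ∧ dist (meshPoint δ f) x ≤ 2 * r ∧
        R / 2 ≤ dist (meshPoint δ w) x ∧ R / 2 ≤ dist (meshPoint δ g) x ∧
        ω ∈ openConnIn S v w ∧ dualConfig ω ∈ openConnIn S f g} ≤ C * (r / R) ^ θ) →
    ∀ {α ca : ℝ}, 0 < α → 0 < ca →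
    (∀ (x : ℂ) (δ r R : ℝ), 0 < δ → ca * δ ≤ r → 2 * r ≤ R →
      (bondPercolation (zdGraph 2) half).real (annulusDualCrossing x δ r R) ≤ (r / R) ^ α) →
    ∀ (η : ℝ), 0 < η → η < 1 → η < θ + α →
    ∃ C' cb' K' : ℝ, 0 < C' ∧ 0 < cb' ∧ 1 ≤ K' ∧ ∀ (c₀ : Site 2) (r R : ℝ), cb' ≤ r → K' * r ≤ R →
    (bondPercolation (zdGraph 2) half).real {ω | ∃ v w f g : Site 2,
        dist (meshPoint 1 v) (meshPoint 1 c₀) ≤ 2 * r ∧ dist (meshPoint 1 f) (meshPoint 1 c₀) ≤ 2 * r ∧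
        R / 2 ≤ dist (meshPoint 1 w) (meshPoint 1 c₀) ∧ R / 2 ≤ dist (meshPoint 1 g) (meshPoint 1 c₀) ∧
        ω ∈ openConnIn {v : Site 2 | r ≤ dist (meshPoint 1 v) (meshPoint 1 c₀) ∧
          dist (meshPoint 1 v) (meshPoint 1 c₀) ≤ R ∧ (meshPoint 1 c₀).im ≤ (meshPoint 1 v).im} v w ∧
        dualConfig ω ∈ openConnIn {v : Site 2 | r ≤ dist (meshPoint 1 v) (meshPoint 1 c₀) ∧
          dist (meshPoint 1 v) (meshPoint 1 c₀) ≤ R ∧ (meshPoint 1 c₀).im ≤ (meshPoint 1 v).im} f g} ≤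
      C' * (r / R) ^ η := by
  intro θ C cb K hθ hC hcb hK hX α ca hα hca hRSW η hη0 hη1 hηκ
  obtain ⟨Cd, Kd, hCd, hKd, hsum⟩ := stub_undockedTwoArm_sumBound hθ hC hcb hK hX hα hca hRSW
  -- exponents
  set κ : ℝ := θ + α with hκ
  set γ : ℝ := (min 1 κ - η) / 2 with hγ
  have hκ0 : 0 < κ := by rw [hκ]; linarith
  have hγ0 : 0 < γ := by
    rw [hγ]; have : η < min 1 κ := lt_min hη1 hηκ; linarith
  have hγκ : γ ≤ κ - η := by rw [hγ]; have := min_le_right 1 κ; linarith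
  set m₀ : ℝ := max (1 - κ) 0 with hm₀
  have hm₀0 : 0 ≤ m₀ := le_max_right _ _
  have hκm : 1 - κ ≤ m₀ := le_max_left _ _
  have hexp : γ + γ + m₀ + (-1) = -η := by rw [hγ, hm₀]; have := min_add_max_eq_one κ; linarith
  -- the constants `A`, `A'` and the ratio `L`
  set A : ℝ := 2 * C * 2 ^ θ * 32 ^ α with hA
  set A' : ℝ := max 1 A with hA'
  have hA0 : 0 ≤ A := by rw [hA]; positivity
  have hA'1 : 1 ≤ A' := le_max_left _ _
  have hAA' : A ≤ A' := le_max_right _ _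
  set L : ℝ := max (max 32 (2 * K)) (A' ^ (1 / γ)) with hL
  have hLmax : max 32 (2 * K) ≤ L := le_max_left _ _
  have hL32 : 32 ≤ L := le_trans (le_max_left _ _) hLmax
  have hL1 : 1 < L := by linarith
  have hL0 : 0 < L := by linarith
  have hLγ : A' ≤ L ^ γ := by
    have h1 : A' ^ (1 / γ) ≤ L := le_max_right _ _
    have h2 : (A' ^ (1 / γ)) ^ γ ≤ L ^ γ := Real.rpow_le_rpow (by positivity) h1 hγ0.le
    rwa [← Real.rpow_mul (by linarith), one_div_mul_cancel hγ0.ne', Real.rpow_one] at h2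
  have hb0 : 0 < L ^ γ - 1 := by have := Real.one_lt_rpow hL1 hγ0; linarith
  -- the final constants
  set C₁ : ℝ := Cd * L / (2 * Kd * (L ^ γ - 1)) with hC₁
  have hC₁0 : 0 < C₁ := div_pos (mul_pos hCd hL0) (mul_pos (by positivity) hb0)
  have hK' : 1 ≤ 3 * Kd * L := by
    have := mul_le_mul hKd hL1.le zero_le_one (by linarith); linarith
  refine ⟨(C₁ + L ^ κ) * (Kd ^ η * 3 ^ η), max (2 * cb) (max ca 16), 3 * Kd * L, by positivity, by positivity,
    hK', fun c₀ r R hr hR => ?_⟩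
  set r₀ : ℝ := 2 * r + 9 with hr₀
  have hr16 : 16 ≤ r := le_trans ((le_max_right _ _).trans (le_max_right _ _)) hr
  have hr₀0 : 0 < r₀ := by rw [hr₀]; linarith
  have hr₀3 : r₀ ≤ 3 * r := by rw [hr₀]; linarith
  set X : ℝ := R / (Kd * r₀) with hX'
  have hKr : 0 < Kd * r₀ := by positivity
  have hXL : L ≤ X := by
    rw [hX', le_div_iff₀ hKr]
    calc L * (Kd * r₀) ≤ L * (Kd * (3 * r)) := by gcongr
      _ = 3 * Kd * L * r := by ring
      _ ≤ R := hR
  have hX1 : 1 ≤ X := le_trans hL1.le hXL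
  have hX0 : 0 < X := by linarith
  have hRX : R = X * (Kd * r₀) := by rw [hX', div_mul_cancel₀ _ hKr.ne']
  have hR0 : 0 < R := by rw [hRX]; positivity
  -- the number of scales
  have hexJ : ∃ j : ℕ, X < L ^ (j + 1) := by
    obtain ⟨n, hn⟩ := pow_unbounded_of_one_lt X hL1
    exact ⟨n, hn.trans_le (pow_le_pow_right₀ hL1.le (Nat.le_succ n))⟩
  classical
  set J := Nat.find hexJ with hJ
  have hJspec : X < L ^ (J + 1) := Nat.find_spec hexJ
  have hYX : L ^ J ≤ X := by
    rcases Nat.eq_zero_or_pos J with h0 | hpos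
    · rw [h0, pow_zero]; exact hX1
    · have := Nat.find_min hexJ (show J - 1 < J by omega)
      rw [not_lt, Nat.sub_add_cancel hpos] at this
      exact this
  have hXLY : X < L * L ^ J := by rw [← pow_succ']; exact hJspec
  -- the sum bound at `J` scales
  have hRJ : Kd * (2 * r + 9) * L ^ J ≤ R := by
    have : L ^ J * (Kd * r₀) ≤ X * (Kd * r₀) := mul_le_mul_of_nonneg_right hYX hKr.le
    rw [← hRX] at this
    rw [← hr₀]; linarith
  have hmain := hsum L hLmax c₀ r R J hr hRJ
  have hS := step_sum_le (X := X) hL1 hA0 hAA' hA'1 hLγ hγ0 hm₀0 hκm hYX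
  have hT := step_tail_le hL1 hA0 hAA' hLγ hγ0 hγκ hκ0 hYX hXLY hX1
  -- the first term
  have hT1 : (Cd * (2 * r + 9) * L / (2 * R)) * ∑ j ∈ Finset.range J, (L * (A * L ^ (-κ))) ^ j ≤ C₁ * X ^ (-η) := by
    have hcoef : Cd * (2 * r + 9) * L / (2 * R) = (Cd * L / (2 * Kd)) * X ^ (-(1 : ℝ)) := by
      rw [Real.rpow_neg hX0.le, Real.rpow_one, hRX, ← hr₀]
      field_simp
    have hXpow : X ^ γ / (L ^ γ - 1) * (X ^ γ * X ^ m₀) * X ^ (-(1 : ℝ)) = X ^ (-η) / (L ^ γ - 1) := by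
      rw [← hexp, Real.rpow_add hX0, Real.rpow_add hX0, Real.rpow_add hX0]
      field_simp
    calc (Cd * (2 * r + 9) * L / (2 * R)) * ∑ j ∈ Finset.range J, (L * (A * L ^ (-κ))) ^ j
        ≤ (Cd * (2 * r + 9) * L / (2 * R)) * ((X ^ γ / (L ^ γ - 1)) * (X ^ γ * X ^ m₀)) :=
          mul_le_mul_of_nonneg_left hS (by positivity)
      _ = (Cd * L / (2 * Kd)) * (X ^ γ / (L ^ γ - 1) * (X ^ γ * X ^ m₀) * X ^ (-(1 : ℝ))) := by rw [hcoef]; ring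
      _ = C₁ * X ^ (-η) := by rw [hXpow, hC₁]; field_simp
  -- conversion of `X^{-η}` to `(r/R)^η`
  have hconv : X ^ (-η) ≤ Kd ^ η * 3 ^ η * (r / R) ^ η := by
    have h1 : X ^ (-η) = (Kd * r₀ / R) ^ η := by
      rw [Real.rpow_neg hX0.le, ← Real.inv_rpow hX0.le, hX', inv_div]
    have h2 : Kd * r₀ / R ≤ Kd * 3 * (r / R) := by
      rw [show Kd * 3 * (r / R) = Kd * (3 * r) / R by ring]
      exact div_le_div_of_nonneg_right (by nlinarith) hR0.le
    rw [h1]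
    calc (Kd * r₀ / R) ^ η ≤ (Kd * 3 * (r / R)) ^ η := Real.rpow_le_rpow (by positivity) h2 hη0.le
      _ = Kd ^ η * 3 ^ η * (r / R) ^ η := by
          rw [Real.mul_rpow (by positivity) (by positivity), Real.mul_rpow (by positivity) (by positivity)]
  have hκneg : A * L ^ (-κ) = 2 * C * 2 ^ θ * 32 ^ α * L ^ (-(θ + α)) := by rw [hA, hκ]
  rw [← hκneg] at hmain
  calc _ ≤ _ := hmain
    _ ≤ C₁ * X ^ (-η) + L ^ κ * X ^ (-η) := add_le_add hT1 hT
    _ = (C₁ + L ^ κ) * X ^ (-η) := by ring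
    _ ≤ (C₁ + L ^ κ) * (Kd ^ η * 3 ^ η * (r / R) ^ η) := mul_le_mul_of_nonneg_left hconv (by positivity)
    _ = (C₁ + L ^ κ) * (Kd ^ η * 3 ^ η) * (r / R) ^ η := by ring

end Summit.CriticalPhenomena.CardyFormulaZ2.Cruxes.LagHandOff.HittingTournament
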